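import Mathlib
import Literature.Analysis.FluidPDE.Tao2016AveragedNS.SelfSimilarCascadeBlowup
import HarnessLib

/-!
# A geometric envelope below the dissipation threshold is SELF-IMPROVING under the NS-scaled viscous
  lattice (invariant region / fencing argument, sign-free, general table) — the engine of the
  small-critical-data regularity needed by any absorber construction for the survival step (E2) of
  `stub_eternalFromBlowup` (K2(1) `TaoLadderRungTwoBreak.BlowupRigidityOne`, stmt-NavierStokesRegularity-20206)

MODEL lattice ODEs only (Tao 2016 §4 Lemma 4.1 (4.8) and the viscous lattice before Thm. 4.2); nothing here is a
statement about the Navier–Stokes equations; NO item is closed (`--supports stmt-NavierStokesRegularity-20206`).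
Route-independent module; general `m`; DEF-FREE.

* `abs_quadTerm_le_of_envelope` — under the geometric envelope `|X_{j,k}(t)| ≤ δ(1+ε₀)^{-9k}` (all modes, all
  shells) the cascade nonlinearity obeys `|quadTerm_{i,n}(X)(t)| ≤ 4m²M_α δ² (1+ε₀)^{16 − 31n/2}` (structure constants
  bounded by `M_α`): each of the four shifts of Tao's `S` contributes `M_α δ² (1+ε₀)^{e}` with
  `e = 5(n−μ₃)/2 − 9(n−μ₃+μ₁) − 9(n−μ₃+μ₂) ≤ 16 − 31n/2`.
* `envelope_improves` — **THE FENCE.** Let `X` be continuous on `[0,s]`, solve the `ν`-viscous lattice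
  `∂ₜX_{i,n} = quadTerm_{i,n}(X) − ν(1+ε₀)^{2n}X_{i,n}` on `[0,s]` (one-sided derivatives within `[0,s]`), vanish below
  shell `0`, start from a one-shell datum with `|X₀ᵢ| ≤ δ/2`, and obey the envelope `|X_{i,n}(t)| ≤ δ(1+ε₀)^{-9n}` on
  `[0,s]`. If `8m²M_α(1+ε₀)^{16} δ < ν` then the envelope holds with `δ/2`: `|X_{i,n}(t)| ≤ (δ/2)(1+ε₀)^{-9n}`. Proof:
  for `n ≥ 0` fence `X_{i,n}²` by the constant `(δ/2)²(1+ε₀)^{-18n}` (Mathlib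
  `image_le_of_deriv_right_lt_deriv_boundary`): at contact `|X| = (δ/2)(1+ε₀)^{-9n}` the dissipation
  `ν(1+ε₀)^{2n}X²` beats `|X|·|quadTerm| ≤ |X|·4m²M_αδ²(1+ε₀)^{16−31n/2}` because the ratio is
  `8m²M_α δ(1+ε₀)^{16}(1+ε₀)^{-17n/2}/ν < 1`.

WHAT IT IS FOR. The improvement `δ ↦ δ/2` is the invariant-region step of a Kato-type SMALL-CRITICAL-DATA theorem for
the damped lattice: with the continuity of finitely many low shells and the a priori weight (4.5) on the high ones,
a routine open–closed argument upgrades it to «the envelope `δ(1+ε₀)^{-9n}` persists on every `[0,s]`», which feeds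
the tree's `exists_viscousGlobal_of_subcriticalEnvelope` (tail energies `≤ C(1+ε₀)^{-18n}`) and yields a GLOBAL regular
viscous solution — the regularity statement an absorber/gain-field construction (`hasGlobal_of_gainField`) needs to
turn «the blow-up front became sub-critical» into «a global pseudo-solution exists». This file lands the step; the
open–closed bootstrap is left to the next hand (census (L4)).

HONEST LABEL: an a priori estimate for the damped model lattice; no stub, crux or summit is proved; rung 0.
-/

noncomputable section

-- the summit and its single sub-problem share the name (CONVENTIONS §1)
set_option linter.dupNamespace false

open Set Filter Topology

namespace Summit.NavierStokesRegularity.NavierStokesRegularity.Theorems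

namespace BlowupRigidityOne

open Literature.Analysis.FluidPDE Literature.Analysis.FluidPDE.TaoCascade

variable {m : ℕ}

/-- Tao's shift set has four elements. [cite: Tao2016AveragedNS, §4 (4.1)] -/
theorem card_shiftSet : shiftSet.card = 4 := by
  simp [shiftSet]

/-- On Tao's shift set the exponent bookkeeping of one monomial under the envelope `(1+ε₀)^{-9k}`:
`5(n−μ₃)/2 − 9(n−μ₃+μ₁) − 9(n−μ₃+μ₂) ≤ 16 − 31n/2`. [cite: Tao2016AveragedNS, §4 (4.1), (4.8)] -/
theorem shift_exponent_le {μ : ℤ × ℤ × ℤ} (hμ : μ ∈ shiftSet) (n : ℤ) :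
    (5 : ℝ) * ((n : ℝ) - (μ.2.2 : ℝ)) / 2 + -((9 : ℝ) * (((n - μ.2.2 + μ.1 : ℤ)) : ℝ))
        + -((9 : ℝ) * (((n - μ.2.2 + μ.2.1 : ℤ)) : ℝ)) ≤ 16 - (31 / 2 : ℝ) * n := by
  rcases (mem_shiftSet_iff μ).1 hμ with rfl | rfl | rfl | rfl <;> push_cast <;> nlinarith

/-- **The nonlinearity under a geometric envelope.** If `|α| ≤ M_α` and `|X_{j,k}(t)| ≤ δ(1+ε₀)^{-9k}` for all modes
and shells at time `t` (`ε₀ > 0`, `δ ≥ 0`), then `|quadTerm_{i,n}(X)(t)| ≤ 4 m² M_α δ² (1+ε₀)^{16 − 31n/2}`.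
[cite: Tao2016AveragedNS, §4 (4.1), Lemma 4.1 (4.8)] -/
theorem abs_quadTerm_le_of_envelope {ε₀ Mα δ : ℝ} (hε : 0 < ε₀) (hδ : 0 ≤ δ)
    {α : Fin m → Fin m → Fin m → ℤ × ℤ × ℤ → ℝ} (hα : ∀ i₁ i₂ i₃ μ, |α i₁ i₂ i₃ μ| ≤ Mα)
    {X : Fin m → ℤ → ℝ → ℝ} {t : ℝ}
    (henv : ∀ (j : Fin m) (k : ℤ), |X j k t| ≤ δ * (1 + ε₀) ^ (-((9 : ℝ) * k))) (i : Fin m) (n : ℤ) :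
    |quadTerm ε₀ α X i n t| ≤
      4 * (m : ℝ) ^ 2 * Mα * δ ^ 2 * (1 + ε₀) ^ ((16 : ℝ) - (31 / 2 : ℝ) * n) := by
  have hb : 0 < 1 + ε₀ := by linarith
  have hb1 : 1 ≤ 1 + ε₀ := by linarith
  have hMα : 0 ≤ Mα := by
    rcases Nat.eq_zero_or_pos m with h | h
    · exact absurd i.isLt (by omega)
    · exact (abs_nonneg _).trans (hα i i i (0, 0, 0))
  set W : ℝ := Mα * δ ^ 2 * (1 + ε₀) ^ ((16 : ℝ) - (31 / 2 : ℝ) * n) with hW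
  -- one monomial
  have hterm : ∀ (i₁ i₂ : Fin m), ∀ μ ∈ shiftSet,
      |α i₁ i₂ i μ * (1 + ε₀) ^ ((5 : ℝ) * (n - μ.2.2) / 2) *
          (X i₁ (n - μ.2.2 + μ.1) t * X i₂ (n - μ.2.2 + μ.2.1) t)| ≤ W := by
    intro i₁ i₂ μ hμ
    have hp : 0 < (1 + ε₀) ^ ((5 : ℝ) * (n - μ.2.2) / 2) := Real.rpow_pos_of_pos hb _
    rw [abs_mul, abs_mul, abs_mul, abs_of_pos hp]
    have h1 := henv i₁ (n - μ.2.2 + μ.1)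
    have h2 := henv i₂ (n - μ.2.2 + μ.2.1)
    have hq1 : 0 ≤ δ * (1 + ε₀) ^ (-((9 : ℝ) * ((n - μ.2.2 + μ.1 : ℤ) : ℝ))) :=
      mul_nonneg hδ (Real.rpow_nonneg hb.le _)
    calc |α i₁ i₂ i μ| * (1 + ε₀) ^ ((5 : ℝ) * (n - μ.2.2) / 2) *
          (|X i₁ (n - μ.2.2 + μ.1) t| * |X i₂ (n - μ.2.2 + μ.2.1) t|)
        ≤ Mα * (1 + ε₀) ^ ((5 : ℝ) * (n - μ.2.2) / 2) *
          ((δ * (1 + ε₀) ^ (-((9 : ℝ) * ((n - μ.2.2 + μ.1 : ℤ) : ℝ)))) *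
            (δ * (1 + ε₀) ^ (-((9 : ℝ) * ((n - μ.2.2 + μ.2.1 : ℤ) : ℝ))))) :=
          mul_le_mul (mul_le_mul_of_nonneg_right (hα i₁ i₂ i μ) hp.le)
            (mul_le_mul h1 h2 (abs_nonneg _) hq1) (mul_nonneg (abs_nonneg _) (abs_nonneg _))
            (mul_nonneg hMα hp.le)
      _ = Mα * δ ^ 2 * ((1 + ε₀) ^ ((5 : ℝ) * (n - μ.2.2) / 2) *
            (1 + ε₀) ^ (-((9 : ℝ) * ((n - μ.2.2 + μ.1 : ℤ) : ℝ))) *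
            (1 + ε₀) ^ (-((9 : ℝ) * ((n - μ.2.2 + μ.2.1 : ℤ) : ℝ)))) := by ring
      _ = Mα * δ ^ 2 * (1 + ε₀) ^ ((5 : ℝ) * (n - μ.2.2) / 2 +
            -((9 : ℝ) * ((n - μ.2.2 + μ.1 : ℤ) : ℝ)) + -((9 : ℝ) * ((n - μ.2.2 + μ.2.1 : ℤ) : ℝ))) := by
          rw [Real.rpow_add hb, Real.rpow_add hb]
      _ ≤ Mα * δ ^ 2 * (1 + ε₀) ^ ((16 : ℝ) - (31 / 2 : ℝ) * n) := by
          apply mul_le_mul_of_nonneg_left _ (mul_nonneg hMα (sq_nonneg δ))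
          exact Real.rpow_le_rpow_of_exponent_le hb1 (shift_exponent_le hμ n)
  -- sum the monomials
  unfold quadTerm
  calc |∑ i₁, ∑ i₂, ∑ μ ∈ shiftSet, α i₁ i₂ i μ * (1 + ε₀) ^ ((5 : ℝ) * (n - μ.2.2) / 2) *
          (X i₁ (n - μ.2.2 + μ.1) t * X i₂ (n - μ.2.2 + μ.2.1) t)|
      ≤ ∑ i₁, |∑ i₂, ∑ μ ∈ shiftSet, α i₁ i₂ i μ * (1 + ε₀) ^ ((5 : ℝ) * (n - μ.2.2) / 2) *
          (X i₁ (n - μ.2.2 + μ.1) t * X i₂ (n - μ.2.2 + μ.2.1) t)| := Finset.abs_sum_le_sum_abs _ _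
    _ ≤ ∑ i₁ : Fin m, ∑ i₂ : Fin m, ((4 : ℝ) * W) := by
        refine Finset.sum_le_sum fun i₁ _ => ?_
        refine (Finset.abs_sum_le_sum_abs _ _).trans (Finset.sum_le_sum fun i₂ _ => ?_)
        refine (Finset.abs_sum_le_sum_abs _ _).trans ?_
        calc ∑ μ ∈ shiftSet, |α i₁ i₂ i μ * (1 + ε₀) ^ ((5 : ℝ) * (n - μ.2.2) / 2) *
              (X i₁ (n - μ.2.2 + μ.1) t * X i₂ (n - μ.2.2 + μ.2.1) t)|
            ≤ ∑ μ ∈ shiftSet, W := Finset.sum_le_sum fun μ hμ => hterm i₁ i₂ μ hμ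
          _ = 4 * W := by rw [Finset.sum_const, card_shiftSet, nsmul_eq_mul]; norm_num
    _ = 4 * (m : ℝ) ^ 2 * Mα * δ ^ 2 * (1 + ε₀) ^ ((16 : ℝ) - (31 / 2 : ℝ) * n) := by
        rw [Finset.sum_const, Finset.sum_const, Finset.card_univ, Fintype.card_fin, nsmul_eq_mul, nsmul_eq_mul,
          hW]
        ring

/-- **THE FENCE: a sub-threshold geometric envelope improves itself.** Let `ε₀ > 0`, `ν > 0`, `|α| ≤ M_α`,
`0 < δ` with `8 m² M_α (1+ε₀)^{16} δ < ν`. Let `X` be continuous on `[0,s]` shell-wise, solve the `ν`-viscous lattice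
on `[0,s]` (one-sided derivatives within `[0,s]`), vanish below shell `0`, start from the one-shell datum `X₀` at shell
`0` with `|X₀ᵢ| ≤ δ/2`, and satisfy the envelope `|X_{i,n}(t)| ≤ δ(1+ε₀)^{-9n}` on `[0,s]` for all modes and shells.
Then `|X_{i,n}(t)| ≤ (δ/2)(1+ε₀)^{-9n}` on `[0,s]` (`ν > 0` is implied by the smallness hypothesis).
[cite: Tao2016AveragedNS, §4 Lemma 4.1 (4.8) and the viscous lattice before Thm. 4.2; BarbatoMorandinRomito2011, §3.1 Prop. 3.3 (invariant region, m = 1 prototype)] -/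
theorem envelope_improves {ε₀ ν Mα δ s : ℝ} (hε : 0 < ε₀) (hδ : 0 < δ)
    {α : Fin m → Fin m → Fin m → ℤ × ℤ × ℤ → ℝ} (hα : ∀ i₁ i₂ i₃ μ, |α i₁ i₂ i₃ μ| ≤ Mα)
    (hsmall : 8 * (m : ℝ) ^ 2 * Mα * (1 + ε₀) ^ (16 : ℝ) * δ < ν)
    {X₀ : Fin m → ℝ} (hX₀ : ∀ i, |X₀ i| ≤ δ / 2)
    {X : Fin m → ℤ → ℝ → ℝ}
    (hinit : ∀ i k, X i k 0 = if k = 0 then X₀ i else 0)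
    (hnoLow : ∀ i k, k < 0 → ∀ t, X i k t = 0)
    (hcont : ∀ i k, ContinuousOn (X i k) (Icc 0 s))
    (hderiv : ∀ i k, ∀ t ∈ Icc 0 s, HasDerivWithinAt (X i k)
      (quadTerm ε₀ α X i k t - ν * (1 + ε₀) ^ ((2 : ℝ) * k) * X i k t) (Icc 0 s) t)
    (henv : ∀ (i : Fin m) (k : ℤ), ∀ t ∈ Icc 0 s, |X i k t| ≤ δ * (1 + ε₀) ^ (-((9 : ℝ) * k))) :
    ∀ (i : Fin m) (k : ℤ), ∀ t ∈ Icc 0 s, |X i k t| ≤ δ / 2 * (1 + ε₀) ^ (-((9 : ℝ) * k)) := by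
  intro i k t ht
  have hb : 0 < 1 + ε₀ := by linarith
  have hb1 : 1 ≤ 1 + ε₀ := by linarith
  have hek : 0 < (1 + ε₀) ^ (-((9 : ℝ) * k)) := Real.rpow_pos_of_pos hb _
  -- shells below `0` vanish
  rcases lt_or_ge k 0 with hk | hk
  · rw [hnoLow i k hk t, abs_zero]; positivity
  -- the fence for `f = X_{i,k}²` with the constant barrier `e² `, `e = (δ/2)(1+ε₀)^{-9k}`
  set e : ℝ := δ / 2 * (1 + ε₀) ^ (-((9 : ℝ) * k)) with he_def
  have he : 0 < e := by positivity
  have hMα : 0 ≤ Mα := by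
    rcases Nat.eq_zero_or_pos m with h | h
    · exact absurd i.isLt (by omega)
    · exact (abs_nonneg _).trans (hα i i i (0, 0, 0))
  -- derivative of the square within `Ici x`
  set D : ℝ → ℝ := fun x => quadTerm ε₀ α X i k x - ν * (1 + ε₀) ^ ((2 : ℝ) * k) * X i k x with hD
  have hf' : ∀ x ∈ Ico 0 s, HasDerivWithinAt (fun y => X i k y * X i k y)
      (D x * X i k x + X i k x * D x) (Ici x) x := by
    intro x hx
    have h1 : HasDerivWithinAt (X i k) (D x) (Ici x) x :=
      (hderiv i k x (Ico_subset_Icc_self hx)).mono_of_mem_nhdsWithin (Icc_mem_nhdsGE_of_mem hx)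
    exact h1.mul h1
  have hfc : ContinuousOn (fun y => X i k y * X i k y) (Icc 0 s) := (hcont i k).mul (hcont i k)
  -- initial value under the barrier
  have h0 : X i k 0 * X i k 0 ≤ e ^ 2 := by
    rw [hinit i k]
    split_ifs with hk0
    · subst hk0
      have : |X₀ i| ≤ e := by
        rw [he_def]; simp only [Int.cast_zero, mul_zero, neg_zero, Real.rpow_zero, mul_one]; exact hX₀ i
      have h2 : X₀ i * X₀ i = |X₀ i| ^ 2 := by rw [sq_abs]; ring
      rw [h2]
      exact pow_le_pow_left₀ (abs_nonneg _) this 2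
    · rw [mul_zero]; positivity
  -- contact: `X² = e²` forces `X·X' < 0`
  have hbound : ∀ x ∈ Ico 0 s, X i k x * X i k x = e ^ 2 → D x * X i k x + X i k x * D x < 0 := by
    intro x hx hcontact
    have hxI : x ∈ Icc 0 s := Ico_subset_Icc_self hx
    have habs : |X i k x| = e := by
      have h2 : |X i k x| ^ 2 = e ^ 2 := by rw [sq_abs, sq]; exact hcontact
      exact (pow_left_inj₀ (abs_nonneg _) he.le two_ne_zero).1 h2
    -- the nonlinearity under the envelope at time `x`
    have hq := abs_quadTerm_le_of_envelope hε hδ.le hα (fun j k' => henv j k' x hxI) i k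
    -- dissipation beats it at contact
    have hlam : 0 < (1 + ε₀) ^ ((2 : ℝ) * k) := Real.rpow_pos_of_pos hb _
    have hkey : 4 * (m : ℝ) ^ 2 * Mα * δ ^ 2 * (1 + ε₀) ^ ((16 : ℝ) - (31 / 2 : ℝ) * k)
        < ν * (1 + ε₀) ^ ((2 : ℝ) * k) * e := by
      -- `(1+ε₀)^{16 − 31k/2} ≤ (1+ε₀)^{16}·(1+ε₀)^{-9k}·(1+ε₀)^{2k}` for `k ≥ 0`
      have hexp : (1 + ε₀) ^ ((16 : ℝ) - (31 / 2 : ℝ) * k)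
          ≤ (1 + ε₀) ^ (16 : ℝ) * ((1 + ε₀) ^ ((2 : ℝ) * k) * (1 + ε₀) ^ (-((9 : ℝ) * k))) := by
        rw [← Real.rpow_add hb, ← Real.rpow_add hb]
        apply Real.rpow_le_rpow_of_exponent_le hb1
        have : (0 : ℝ) ≤ k := by exact_mod_cast hk
        nlinarith
      have hpos16 : 0 < (1 + ε₀) ^ (16 : ℝ) := Real.rpow_pos_of_pos hb _
      calc 4 * (m : ℝ) ^ 2 * Mα * δ ^ 2 * (1 + ε₀) ^ ((16 : ℝ) - (31 / 2 : ℝ) * k)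
          ≤ 4 * (m : ℝ) ^ 2 * Mα * δ ^ 2 *
              ((1 + ε₀) ^ (16 : ℝ) * ((1 + ε₀) ^ ((2 : ℝ) * k) * (1 + ε₀) ^ (-((9 : ℝ) * k)))) :=
            mul_le_mul_of_nonneg_left hexp (by positivity)
        _ = (8 * (m : ℝ) ^ 2 * Mα * (1 + ε₀) ^ (16 : ℝ) * δ) * ((1 + ε₀) ^ ((2 : ℝ) * k) * e) := by
            rw [he_def]; ring
        _ < ν * ((1 + ε₀) ^ ((2 : ℝ) * k) * e) :=
            mul_lt_mul_of_pos_right hsmall (mul_pos hlam he)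
        _ = ν * (1 + ε₀) ^ ((2 : ℝ) * k) * e := by ring
    have hXq : X i k x * quadTerm ε₀ α X i k x ≤ e * (4 * (m : ℝ) ^ 2 * Mα * δ ^ 2 *
        (1 + ε₀) ^ ((16 : ℝ) - (31 / 2 : ℝ) * k)) := by
      calc X i k x * quadTerm ε₀ α X i k x ≤ |X i k x * quadTerm ε₀ α X i k x| := le_abs_self _
        _ = |X i k x| * |quadTerm ε₀ α X i k x| := abs_mul _ _
        _ ≤ e * (4 * (m : ℝ) ^ 2 * Mα * δ ^ 2 * (1 + ε₀) ^ ((16 : ℝ) - (31 / 2 : ℝ) * k)) := by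
            rw [habs]; exact mul_le_mul_of_nonneg_left hq he.le
    have hsq : X i k x * X i k x = e * e := by rw [hcontact, sq]
    have : D x * X i k x + X i k x * D x
        = 2 * (X i k x * quadTerm ε₀ α X i k x) - 2 * (ν * (1 + ε₀) ^ ((2 : ℝ) * k)) * (X i k x * X i k x) := by
      rw [hD]; ring
    rw [this, hsq]
    nlinarith [hkey, hXq, he, hlam]
  -- fence
  have hle := image_le_of_deriv_right_lt_deriv_boundary hfc hf' (B := fun _ => e ^ 2) (B' := fun _ => 0) h0
    (fun x => hasDerivAt_const x (e ^ 2)) hbound ht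
  have h2 : (X i k t) ^ 2 ≤ e ^ 2 := by rw [sq]; exact hle
  exact abs_le_of_sq_le_sq h2 he.le

end BlowupRigidityOne

end Summit.NavierStokesRegularity.NavierStokesRegularity.Theorems

end
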